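import Mathlib
import Summits.KontsevichZagierPeriods.Zeta5Search.ClusterValuationKBounds
import Summits.KontsevichZagierPeriods.Zeta5Search.BigPrimeMinors
import HarnessLib

/-!
# ζ(5) search — THEOREM LB, part 1: class data under the contiguous shift, and the termwise norm bounds

Cell `pub-zeta5` (HONEST FRAMING: systematic search; no irrationality claim unless certified), typer seat
generation 8.  Part 1 of 2 of the Lean proof of gen-2 g8's THEOREM LB (`ClusterValuation.CasoratianClassBound`,
REPORT-gen2-g8 §3.7; part 2 = `CasoratianClassBoundProof.lean`).  Contents:

* MONOTONICITY UNDER `b ↦ b + e_j` (§3.7 (ii)): the shift shrinks one block, so `blockCount` falls, `netExp` and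
  `classExp` rise, poles of `b + e_j` are poles of `b` (`classPoleCount_shift_le`), and the termwise `V`-exponent
  `ν_x` rises (`classNu_shift_ge`, tameness persists);
* the class pieces of a class WITHOUT poles vanish (`classV_eq_zero_of_noPole`, `classK_eq_zero_of_noPole`);
* norm forms of the landed bounds: `‖V_x‖ ≤ p^{−ν_x}`, `‖V(b)‖ ≤ p^{−v}` for any `v` below all `ν_x`
  (`padicNorm_coeffV_le`), `‖𝒦_x‖ ≤ p^{−(3+E_x)}`, `‖𝒦_x‖ ≤ p^{−1}` (single pole);
* reading the `List.min?`-based definitions `vbMin`, `rowMin` of `ClusterValuationPairs.lean`.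
Valuation bookkeeping only; nothing about irrationality.
-/

noncomputable section

open Finset

namespace Summit.KontsevichZagierPeriods.Zeta5Search.ClusterValuation

open Summit.KontsevichZagierPeriods.Zeta5Search.DualSeries (InBox)
open Summit.KontsevichZagierPeriods.Zeta5Search.WedgeDictionary (pfData coeffV dOf)
open Summit.KontsevichZagierPeriods.Zeta5Search.CasoratianValuation (InPolytope shift)
open Summit.KontsevichZagierPeriods.Zeta5Search.BigPrime (block shift_zero)
open Summit.KontsevichZagierPeriods.Zeta5Search.PadicSeries

/-! ### The shift `b ↦ b + e_j` and the class data -/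

section Shift

variable (b : ℕ → ℤ) {j : ℕ}

/-- Raising a lower parameter shrinks its block. -/
theorem block_succ_subset (n β : ℕ) : block n (β + 1) ⊆ block n β := by
  intro s hs
  simp only [block, mem_Icc] at hs ⊢
  omega

/-- `blockCount` does not increase under the shift. -/
theorem blockCount_shift_le (hb : InBox b) (hj1 : 1 ≤ j) (s : ℕ) :
    blockCount (shift b j) s ≤ blockCount b s := by
  unfold blockCount
  rw [shift_zero b hj1]
  refine card_le_card fun i hi => ?_
  rw [mem_filter] at hi ⊢
  refine ⟨hi.1, ?_⟩
  by_cases hij : i + 1 = j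
  · have hβ0 : 0 ≤ b j := by rw [← hij]; exact (hb.2 i hi.1).1
    have hval : shift b j (i + 1) = b j + 1 := by rw [hij]; simp [shift]
    have hnat : (shift b j (i + 1)).toNat = (b (i + 1)).toNat + 1 := by
      rw [hval, hij]; omega
    rw [hnat] at hi
    exact block_succ_subset _ _ hi.2
  · have hval : shift b j (i + 1) = b (i + 1) := by simp [shift, Function.update_of_ne hij]
    rw [hval] at hi
    exact hi.2

/-- `netExp` does not decrease under the shift. -/
theorem netExp_shift_ge (hb : InBox b) (hj1 : 1 ≤ j) (s : ℕ) :
    netExp b s ≤ netExp (shift b j) s := by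
  have h := blockCount_shift_le b hb hj1 s
  unfold netExp
  rw [shift_zero b hj1]
  split_ifs <;> omega

/-- The residue classes are unchanged by the shift. -/
theorem classSet_shift (hj1 : 1 ≤ j) (p x : ℕ) : classSet (shift b j) p x = classSet b p x := by
  unfold classSet; rw [shift_zero b hj1]

/-- The centre condition is unchanged by the shift. -/
theorem centreIn_shift (hj1 : 1 ≤ j) (p x : ℕ) : CentreIn (shift b j) p x ↔ CentreIn b p x := by
  unfold CentreIn; rw [shift_zero b hj1]

/-- The class exponent does not decrease under the shift. -/
theorem classExp_shift_ge (hb : InBox b) (hj1 : 1 ≤ j) (p x : ℕ) :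
    classExp b p x ≤ classExp (shift b j) p x := by
  unfold classExp
  rw [classSet_shift b hj1]
  have h1 := sum_le_sum fun s (_ : s ∈ classSet b p x) => netExp_shift_ge b hb hj1 s
  have hiff : (¬ (2 : ℤ) ∣ shift b j 0 ∧ CentreIn (shift b j) p x) ↔ (¬ (2 : ℤ) ∣ b 0 ∧ CentreIn b p x) := by
    rw [centreIn_shift b hj1, shift_zero b hj1]
  have h2 : (if ¬ (2 : ℤ) ∣ shift b j 0 ∧ CentreIn (shift b j) p x then (1 : ℤ) else 0) =
      (if ¬ (2 : ℤ) ∣ b 0 ∧ CentreIn b p x then (1 : ℤ) else 0) := by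
    by_cases hc : ¬ (2 : ℤ) ∣ b 0 ∧ CentreIn b p x
    · rw [if_pos hc, if_pos (hiff.2 hc)]
    · rw [if_neg hc, if_neg (fun h => hc (hiff.1 h))]
  linarith

/-- Poles of `b + e_j` are poles of `b`, classwise. -/
theorem poleFilter_shift_subset (hb : InBox b) (hj1 : 1 ≤ j) (p x : ℕ) :
    (classSet (shift b j) p x).filter (fun s => netExp (shift b j) s < 0) ⊆
      (classSet b p x).filter (fun s => netExp b s < 0) := by
  intro s hs
  rw [mem_filter] at hs ⊢
  rw [classSet_shift b hj1] at hs
  exact ⟨hs.1, lt_of_le_of_lt (netExp_shift_ge b hb hj1 s) hs.2⟩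

/-- `classPoleCount` does not increase under the shift. -/
theorem classPoleCount_shift_le (hb : InBox b) (hj1 : 1 ≤ j) (p x : ℕ) :
    classPoleCount (shift b j) p x ≤ classPoleCount b p x :=
  card_le_card (poleFilter_shift_subset b hb hj1 p x)

/-- **`ν_x(b + e_j) ≥ ν_x(b)`** for every class keeping a pole (tameness persists under the shift). -/
theorem classNu_shift_ge (hb : InBox b) (hj1 : 1 ≤ j) {p x : ℕ}
    (hpole' : 1 ≤ classPoleCount (shift b j) p x) : classNu b p x ≤ classNu (shift b j) p x := by
  have hE := classExp_shift_ge b hb hj1 p x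
  have hcnt := classPoleCount_shift_le b hb hj1 p x
  unfold classNu
  by_cases h' : classPoleCount (shift b j) p x = 1 ∧ tameSingle (shift b j) p x = true
  · rw [if_pos h']
    split_ifs
    · exact max_le_max hE le_rfl
    · exact hE.trans (le_max_left _ _)
  · rw [if_neg h']
    split_ifs with h
    · -- `b` single and tame ⇒ `b + e_j` single and tame: contradiction with `h'`
      exfalso
      apply h'
      obtain ⟨hc1, htame⟩ := h
      have hc1' : classPoleCount (shift b j) p x = 1 := by omega
      refine ⟨hc1', ?_⟩
      obtain ⟨q, hq, hqpole, hor⟩ := (tameSingle_iff b p x).1 htame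
      -- the pole of `b + e_j` is a pole of `b`, hence it is `q`
      obtain ⟨q', hq'⟩ := card_pos.1 (by unfold classPoleCount at hc1'; omega :
        0 < ((classSet (shift b j) p x).filter fun s => netExp (shift b j) s < 0).card)
      have hq'b := poleFilter_shift_subset b hb hj1 p x hq'
      obtain ⟨a, ha⟩ := card_eq_one.1 (show ((classSet b p x).filter fun s => netExp b s < 0).card = 1 from hc1)
      have e1 : q' = a := by simpa [ha] using hq'b
      have e2 : q = a := by
        have : q ∈ (classSet b p x).filter fun s => netExp b s < 0 := mem_filter.2 ⟨hq, hqpole⟩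
        simpa [ha] using this
      have hqq : q' = q := by rw [e1, e2]
      rw [tameSingle_iff]
      refine ⟨q, by rw [classSet_shift b hj1]; exact hq, by rw [← hqq]; exact (mem_filter.1 hq').2, ?_⟩
      rcases hor with hqp | hall
      · exact Or.inl hqp
      · refine Or.inr fun s hs hsq => ?_
        rw [classSet_shift b hj1] at hs
        exact lt_of_lt_of_le (hall s hs hsq) (netExp_shift_ge b hb hj1 s)
    · exact hE

end Shift

/-! ### Classes without poles carry nothing -/

variable {p : ℕ} [hp : Fact p.Prime]

omit hp in
/-- In a class without poles every member is a non-pole. -/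
theorem netExp_nonneg_of_noPole (b : ℕ → ℤ) {x s : ℕ} (h0 : classPoleCount b p x = 0) (hs : s ∈ classSet b p x) :
    0 ≤ netExp b s := by
  by_contra hneg
  push Not at hneg
  have : s ∈ (classSet b p x).filter fun t => netExp b t < 0 := mem_filter.2 ⟨hs, hneg⟩
  unfold classPoleCount at h0
  rw [card_eq_zero] at h0
  rw [h0] at this
  simp at this

omit hp in
/-- `V_x = 0` for a class without poles. -/
theorem classV_eq_zero_of_noPole (b : ℕ → ℤ) (hb : InPolytope b) {x : ℕ} (h0 : classPoleCount b p x = 0) :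
    classV b p x = 0 := by
  unfold classV
  refine sum_eq_zero fun q hq => sum_eq_zero fun o ho => ?_
  rw [pfData_eq_zero_of_netExp_nonneg b hb ((mem_classSet_iff b x q).1 hq).1 (netExp_nonneg_of_noPole b h0 hq)
    (mem_range.1 ho), zero_mul]

omit hp in
/-- `𝒦_x = 0` for a class without poles. -/
theorem classK_eq_zero_of_noPole (b : ℕ → ℤ) (hb : InPolytope b) {x : ℕ} (h0 : classPoleCount b p x = 0) :
    classK b p x = 0 := by
  unfold classK
  refine sum_eq_zero fun q hq => sum_eq_zero fun o ho => ?_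
  rw [pfData_eq_zero_of_netExp_nonneg b hb ((mem_classSet_iff b x q).1 hq).1 (netExp_nonneg_of_noPole b h0 hq)
    (mem_range.1 ho), zero_mul]

/-! ### Norm forms of the class bounds -/

/-- `‖V_x‖_p ≤ p^{−ν_x}` for a pole class. -/
theorem padicNorm_classV_le (b : ℕ → ℤ) (hb : InPolytope b) (hp5 : 5 ≤ p) (hwin : (b 0 + 2 : ℤ) < (p : ℤ) ^ 2)
    {x : ℕ} (hx : x < p) (hpole : 1 ≤ classPoleCount b p x) :
    padicNorm p (classV b p x) ≤ (p : ℚ) ^ (-classNu b p x) :=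
  padicNorm_le_of_val fun h => classNuBound_holds b p x hb hp.out hp5 hwin hx hpole h

/-- `‖V(b)‖_p ≤ p^{−v}` for any `v` below the `ν_x` of all pole classes. -/
theorem padicNorm_coeffV_le (b : ℕ → ℤ) (hb : InPolytope b) (hp5 : 5 ≤ p) (hwin : (b 0 + 2 : ℤ) < (p : ℤ) ^ 2)
    (v : ℤ) (hv : ∀ x, x < p → 1 ≤ classPoleCount b p x → v ≤ classNu b p x) :
    padicNorm p (coeffV b) ≤ (p : ℚ) ^ (-v) := by
  rw [coeffV_eq_sum_classV b hp.out.pos]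
  refine padicNorm.sum_le' (fun x hx => ?_) (zpow_p_nonneg _)
  have hx' := mem_range.1 hx
  rcases Nat.eq_zero_or_pos (classPoleCount b p x) with h0 | hpos
  · rw [classV_eq_zero_of_noPole b hb h0, padicNorm.zero]; exact zpow_p_nonneg _
  · exact (padicNorm_classV_le b hb hp5 hwin hx' hpos).trans (zpow_le_zpow_right₀ one_le_p (by linarith [hv x hx' hpos]))

/-- `‖𝒦_x‖_p ≤ p^{−(3+E_x)}` for a pole class. -/
theorem padicNorm_classK_le_multi (b : ℕ → ℤ) (hb : InPolytope b) (hp5 : 5 ≤ p) (hwin : (b 0 + 2 : ℤ) < (p : ℤ) ^ 2)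
    {x : ℕ} (hx : x < p) (hpole : 1 ≤ classPoleCount b p x) :
    padicNorm p (classK b p x) ≤ (p : ℚ) ^ (-(3 + classExp b p x)) :=
  padicNorm_le_of_val fun h => multipoleClassKBound_holds b p x hb hp.out hp5 hwin hx hpole h

/-- `‖𝒦_x‖_p ≤ p^{−1}` for a single-pole class. -/
theorem padicNorm_classK_le_single (b : ℕ → ℤ) (hb : InPolytope b) (hp5 : 5 ≤ p) (hwin : (b 0 + 2 : ℤ) < (p : ℤ) ^ 2)
    {x : ℕ} (hx : x < p) (hone : classPoleCount b p x = 1) :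
    padicNorm p (classK b p x) ≤ (p : ℚ) ^ (-(1 : ℤ)) :=
  padicNorm_le_of_val fun h => singlePoleClassKBound_holds b p x hb hp.out hp5 hwin hx hone h

/-! ### Reading `vbMin` and `rowMin` -/

omit hp in
/-- `VB(b,p)` is below every `ν_x` of a pole class. -/
theorem vbMin_le (b : ℕ → ℤ) {v : ℤ} (h : vbMin b p = some v) {x : ℕ} (hx : x < p)
    (hpole : 1 ≤ classPoleCount b p x) : v ≤ classNu b p x := by
  refine (List.min?_eq_some_iff.1 h).2 _ (List.mem_map.2 ⟨x, ?_, rfl⟩)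
  exact List.mem_filter.2 ⟨List.mem_range.2 hx, by simpa using hpole⟩

omit hp in
/-- If some class has a pole, `VB(b,p)` is defined. -/
theorem vbMin_isSome (b : ℕ → ℤ) {x : ℕ} (hx : x < p) (hpole : 1 ≤ classPoleCount b p x) :
    ∃ v, vbMin b p = some v := by
  by_contra h
  push Not at h
  have hnone : vbMin b p = none := Option.eq_none_iff_forall_ne_some.2 (fun v hv => h v hv)
  have hnil := List.min?_eq_none_iff.1 hnone
  have hmem : classNu b p x ∈ ((List.range p).filter fun y => 1 ≤ classPoleCount b p y).map (classNu b p) :=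
    List.mem_map.2 ⟨x, List.mem_filter.2 ⟨List.mem_range.2 hx, by simpa using hpole⟩, rfl⟩
  rw [hnil] at hmem
  simp at hmem

omit hp in
/-- The row list of `rowMin`. -/
theorem mem_rowList (b : ℕ → ℤ) {x : ℕ} (hx : x < p) {z : ℤ}
    (hz : (if classPoleCount b p x = 1 then some 1
      else if 2 ≤ classPoleCount b p x then some (3 + classExp b p x) else none) = some z) :
    z ∈ ((List.range p).filterMap fun y =>
        if classPoleCount b p y = 1 then some 1
        else if 2 ≤ classPoleCount b p y then some (3 + classExp b p y) else none)
      ++ (if dOf b < (p : ℤ) then [0] else []) :=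
  List.mem_append.2 (Or.inl (List.mem_filterMap.2 ⟨x, List.mem_range.2 hx, hz⟩))

omit hp in
/-- `rowMin ≤ 1` when some class has exactly one pole. -/
theorem rowMin_le_one (b : ℕ → ℤ) {r : ℤ} (h : rowMin b p = some r) {x : ℕ} (hx : x < p)
    (hone : classPoleCount b p x = 1) : r ≤ 1 :=
  (List.min?_eq_some_iff.1 h).2 _ (mem_rowList b hx (by rw [if_pos hone]))

omit hp in
/-- `rowMin ≤ 3 + E_x` for every multipole class. -/
theorem rowMin_le_multi (b : ℕ → ℤ) {r : ℤ} (h : rowMin b p = some r) {x : ℕ} (hx : x < p)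
    (htwo : 2 ≤ classPoleCount b p x) : r ≤ 3 + classExp b p x :=
  (List.min?_eq_some_iff.1 h).2 _ (mem_rowList b hx (by rw [if_neg (by omega), if_pos htwo]))

omit hp in
/-- `rowMin ≤ 0` beyond the excess (`p > d(b)`). -/
theorem rowMin_le_zero (b : ℕ → ℤ) {r : ℤ} (h : rowMin b p = some r) (hd : dOf b < (p : ℤ)) : r ≤ 0 :=
  (List.min?_eq_some_iff.1 h).2 _ (List.mem_append.2 (Or.inr (by rw [if_pos hd]; simp)))

omit hp in
/-- If some class has a pole, `rowMin` is defined. -/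
theorem rowMin_isSome (b : ℕ → ℤ) {x : ℕ} (hx : x < p) (hpole : 1 ≤ classPoleCount b p x) :
    ∃ r, rowMin b p = some r := by
  by_contra h
  push Not at h
  have hnone : rowMin b p = none := Option.eq_none_iff_forall_ne_some.2 (fun v hv => h v hv)
  have hnil := List.min?_eq_none_iff.1 hnone
  have hz : ∃ z : ℤ, (if classPoleCount b p x = 1 then some (1 : ℤ)
      else if 2 ≤ classPoleCount b p x then some (3 + classExp b p x) else none) = some z := by
    by_cases h1 : classPoleCount b p x = 1
    · exact ⟨1, by rw [if_pos h1]⟩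
    · exact ⟨3 + classExp b p x, by rw [if_neg h1, if_pos (by omega)]⟩
  obtain ⟨z, hz⟩ := hz
  have hmem := mem_rowList b hx hz
  rw [hnil] at hmem
  simp at hmem

end Summit.KontsevichZagierPeriods.Zeta5Search.ClusterValuation

end
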